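import Summits.QuantumFields.BalabanUV.T4Continuum.Support.ShellMeasurePlaquetteCubicLocatedDichOut
import Summits.QuantumFields.BalabanUV.T4Continuum.Support.ShellMeasurePlaquetteCubicLocatedDichWitness

/-!
# `T4Continuum.ShellMeasurePlaquetteCubicFrozenWitness` — REPAIR of F-ne7cleaf02g9-1, part 6 (row S77 f6, owner's
# condition (2) ∕ crew rule G-1 for the «HONEST BOUNDARY» road): the frozen-boundary END
# `prop4Hyp_pinned_ord₃_eta_levels_frozen_torusPin` FIRES on a NONEMPTY block — moving bonds = the four bonds of `p₀`,
# `Pl` = the FIVE plaquettes of their stars (full stars), letters = the bonds of the `[-1,2]²` box (twelve of them frozen)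
(cell `pub-balaban`, sub-cell `t4`, spine estimate NE7c (node U5b); NE7c ROUND-2 crew, unit
`b2b-balaban-t4-ne7c-formalise-leaf-02` gen 9; owner RULING R-ne7cp1-g32-3 (journal l.18202); ADDITIVE — imports part 5
`ShellMeasurePlaquetteCubicLocatedDichOut` and part 4 `ShellMeasurePlaquetteCubicLocatedDichWitness` (toy data) ONLY;
[folklore]; toy data `def`s (no `def … : Prop`), 0 sorry, 0 citation tags)

HONEST FRAMING.  Finite four-torus programme, rung (B)+1 only — NOT infinite volume, NOT a mass gap, NOT the Clay
problem, NOT summit progress; (B), `BetaPertHyp`, (B^μ) are not consumed.  NE7c (`T4IndicatorShell.ShellWeightBound`)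
is NOT PRINTED in [Balaban 1983–89] and NOT PROVED; «NE7c ⇐ the named binders» (trigger c3).  A TOY MODEL certifying
that the frozen-boundary binder shapes of part 5 are jointly inhabited with a nonempty block AND genuinely frozen
exterior letters; nothing printed is asserted; nothing of Bałaban's is discharged.  HONEST DEPENDENCY (cell): continuum
YM on T⁴ ⇐ BetaPertH ∧ nine spine estimates (0/9 proved); BetaPertH ⇐ (D1) ∧ (D4) ∧ CAP+tail; G-an2-4 gates asym, D1 and
NE2/3/4.

THE TOY.  `d = 2`; MOVING bonds `ι := ↥toyΛ` (part 4: the four bonds of `p₀ = p_{01}(0)`); LETTERS `frΛ` = every bond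
based in the box `[-1,2]²` (32 bonds; the 28 outside `toyΛ` are frozen for the consumer); `frPl` = the five plaquettes
`p₀, p_{01}(−e₁), p_{01}(e₀), p_{01}(e₁), p_{01}(−e₀)` = the union of the stars of the four moving bonds; boundary words
`frBd p = ∂p` (geometric, for every plaquette based in `[-1,1]²`); `U₀ ≡ 1`, `η = 1`, unit weights, `Lc = 1`, `ε = 1∕4`,
`ε₀ = 0`, torus `T = 3`, `δ′ = 0`; ANY complete normed algebra `𝔸` with a tracial `τ`.
* `fr_hst` — **THE FULL STAR OF EVERY MOVING BOND LIES IN `frPl`** (the owner's `hst`, now consistent), `fr_hbd`∕`fr_hor`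
  (letters in `frΛ`), `fr_hincr`, `fr_hreg`, `fr_frozen_letter` (a letter of `frPl` outside the block exists);
* **`toy_frozen_fires`**: part 5's `prop4Hyp_pinned_ord₃_eta_levels_frozen_torusPin` APPLIED — every hypothesis
  discharged in kernel — `Prop4Hyp (W_pin^{out}) M (1∕8)` with the ORIGINAL stencil constant on a nonempty block.
Nothing in the countdown moves; NE7c NOT PROVED; spine PROVED 0∕9.
-/

noncomputable section

open scoped BigOperators

namespace Summit.QuantumFields.BalabanUV.T4Continuum.ShellMeasurePlaquetteCubicFrozenWitness

open Literature.MathematicalPhysics.QuantumFieldTheory.Balaban1983to89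
open B7Prop1Explicit (e e_apply U1)
open B8Ineq132 (covDerivFwd)
open B11Prop6Scheme (Prop4Hyp)
open B12Decay510Torus (pl1)
open TreeLengthTorus (TPt proj)
open ShellMeasureWilsonGradientTail (plaqWord bonds)
open ShellMeasurePlaquetteTwist (plaqFunSym)
open ShellMeasureLocalGradientTailJet (ord₃)
open Summit.QuantumFields.BalabanUV.T4Continuum.ShellMeasureCommutatorVariation (plaqStar)
open Summit.QuantumFields.BalabanUV.T4Continuum.ShellMeasureCommutatorGradientLocal (baseSites nbhdSites)
open Summit.QuantumFields.BalabanUV.T4Continuum.ShellMeasureCommutatorLocGrad (ext)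
open Summit.QuantumFields.BalabanUV.T4Continuum.ShellMeasureCommutatorCovDatum
  (covIdx covD unitW unitW_apply norm_covDerivFwd_ext_le)
open Summit.QuantumFields.BalabanUV.T4Continuum.ShellMeasureLocalGradientTail (locGrad)
open Summit.QuantumFields.BalabanUV.T4Continuum.ShellMeasureMultiGridNorms (WSup)
open Summit.QuantumFields.BalabanUV.T4Continuum.ShellMeasureMultiGridNormsMax (WMax)
open Summit.QuantumFields.BalabanUV.T4Continuum.ShellMeasurePinnedNorm (pinW pinDist)
open Summit.QuantumFields.BalabanUV.T4Continuum.ShellMeasureWilsonRemainderLevels (etaScale)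
open Summit.QuantumFields.BalabanUV.T4Continuum.ShellMeasurePlaquetteCubicDictionary (plaqWord_zero_eq)
open Summit.QuantumFields.BalabanUV.T4Continuum.ShellMeasurePlaquetteCubicLocatedDichOut
  (prop4Hyp_pinned_ord₃_eta_levels_frozen_torusPin)
open Summit.QuantumFields.BalabanUV.T4Continuum.ShellMeasurePlaquetteCubicLocatedDichWitness
  (hDv_unit_of_flat toyΛ toy_nonempty mem₀ mem₁ mem₂ mem₃ toyU toy_h₀ toyB₀ toyB₀_nonempty)

export B7Prop1Explicit (Site)

/-! ## §1 The letters, the plaquettes, the boundary words -/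

/-- THE LETTERS: every bond based in the box `[-1,2]²` (moving: the four bonds of `p₀`; the rest frozen). [folklore] -/
def frΛ : Finset (Site 2 × Fin 2) :=
  (Fintype.piFinset fun _ : Fin 2 => Finset.Icc (-1 : ℤ) 2) ×ˢ (Finset.univ : Finset (Fin 2))

/-- THE PLAQUETTES: `p₀` and the four other plaquettes of the stars of its bonds. [folklore] -/
def frPl : Finset (Fin 2 × Fin 2 × Site 2) :=
  {((0 : Fin 2), (1 : Fin 2), (0 : Site 2)), (0, 1, -e 1), (0, 1, e 0), (0, 1, e 1), (0, 1, -e 0)}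

/-- Membership in the letter set is a coordinate condition. [folklore] -/
theorem mem_frΛ_iff {x : Site 2} {μ : Fin 2} : (x, μ) ∈ frΛ ↔ ∀ i, -1 ≤ x i ∧ x i ≤ 2 := by
  simp [frΛ, Fintype.mem_piFinset]

/-- A site of the inner box `[-1,1]²` and its unit translates are based in `[-1,2]²`. [folklore] -/
theorem mem_frΛ_of_inner {x : Site 2} (hx : ∀ i, -1 ≤ x i ∧ x i ≤ 1) (μ : Fin 2) : (x, μ) ∈ frΛ :=
  mem_frΛ_iff.2 fun i => ⟨(hx i).1, by linarith [(hx i).2]⟩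

/-- [folklore] -/
theorem add_e_mem_frΛ_of_inner {x : Site 2} (hx : ∀ i, -1 ≤ x i ∧ x i ≤ 1) (ν μ : Fin 2) : (x + e ν, μ) ∈ frΛ := by
  refine mem_frΛ_iff.2 fun i => ?_
  have h01 : (e ν : Site 2) i = 0 ∨ (e ν : Site 2) i = 1 := by
    rw [e_apply]; split_ifs <;> simp
  obtain ⟨h1, h2⟩ := hx i
  rcases h01 with h | h <;> simp only [Pi.add_apply, h] <;> constructor <;> linarith

/-- THE BOUNDARY WORDS: for a plaquette `p_{μν}(x)` based in the inner box, the geometric word `∂p` with letters in `frΛ`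
oriented `(+,+,−,−)`; elsewhere a junk word (never read: `frPl` is based in the inner box). [folklore] -/
def frBd (p : Fin 2 × Fin 2 × Site 2) : Fin 4 → ↥frΛ × Bool :=
  if hx : ∀ i, -1 ≤ p.2.2 i ∧ p.2.2 i ≤ 1 then
    ![(⟨(p.2.2, p.1), mem_frΛ_of_inner hx p.1⟩, true), (⟨(p.2.2 + e p.1, p.2.1), add_e_mem_frΛ_of_inner hx p.1 p.2.1⟩, true),
      (⟨(p.2.2 + e p.2.1, p.1), add_e_mem_frΛ_of_inner hx p.2.1 p.1⟩, false),
      (⟨(p.2.2, p.2.1), mem_frΛ_of_inner hx p.2.1⟩, false)]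
  else
    ![(⟨((0 : Site 2), (0 : Fin 2)), mem_frΛ_of_inner (fun _ => by simp) 0⟩, true),
      (⟨((0 : Site 2), (0 : Fin 2)), mem_frΛ_of_inner (fun _ => by simp) 0⟩, true),
      (⟨((0 : Site 2), (0 : Fin 2)), mem_frΛ_of_inner (fun _ => by simp) 0⟩, false),
      (⟨((0 : Site 2), (0 : Fin 2)), mem_frΛ_of_inner (fun _ => by simp) 0⟩, false)]

/-- The plaquettes of `frPl` are based in the inner box. [folklore] -/
theorem inner_of_mem_frPl {p : Fin 2 × Fin 2 × Site 2} (hp : p ∈ frPl) : ∀ i, -1 ≤ p.2.2 i ∧ p.2.2 i ≤ 1 := by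
  simp only [frPl, Finset.mem_insert, Finset.mem_singleton] at hp
  rcases hp with rfl | rfl | rfl | rfl | rfl <;> intro i <;> fin_cases i <;> simp [e_apply]

/-- The plaquettes of `frPl` have directions `(0, 1)`. [folklore] -/
theorem dirs_of_mem_frPl {p : Fin 2 × Fin 2 × Site 2} (hp : p ∈ frPl) : p.1 = 0 ∧ p.2.1 = 1 := by
  simp only [frPl, Finset.mem_insert, Finset.mem_singleton] at hp
  rcases hp with rfl | rfl | rfl | rfl | rfl <;> simp

/-- On `frPl` the boundary word is the geometric one. [folklore] -/
theorem frBd_of_inner {p : Fin 2 × Fin 2 × Site 2} (hx : ∀ i, -1 ≤ p.2.2 i ∧ p.2.2 i ≤ 1) :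
    frBd p = ![(⟨(p.2.2, p.1), mem_frΛ_of_inner hx p.1⟩, true),
      (⟨(p.2.2 + e p.1, p.2.1), add_e_mem_frΛ_of_inner hx p.1 p.2.1⟩, true),
      (⟨(p.2.2 + e p.2.1, p.1), add_e_mem_frΛ_of_inner hx p.2.1 p.1⟩, false),
      (⟨(p.2.2, p.2.1), mem_frΛ_of_inner hx p.2.1⟩, false)] := by
  unfold frBd
  rw [dif_pos hx]

/-- `frPl` is increasing. [folklore] -/
theorem fr_hincr : ∀ p ∈ frPl, p.1 < p.2.1 := by
  intro p hp
  obtain ⟨h0, h1⟩ := dirs_of_mem_frPl hp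
  rw [h0, h1]
  exact Fin.zero_lt_one

/-- `frBd p = ∂p` on `frPl`. [folklore] -/
theorem fr_hbd : ∀ p ∈ frPl, ((frBd p 0).1 : Site 2 × Fin 2) = (p.2.2, p.1)
    ∧ ((frBd p 1).1 : Site 2 × Fin 2) = (p.2.2 + e p.1, p.2.1)
    ∧ ((frBd p 2).1 : Site 2 × Fin 2) = (p.2.2 + e p.2.1, p.1) ∧ ((frBd p 3).1 : Site 2 × Fin 2) = (p.2.2, p.2.1) := by
  intro p hp
  rw [frBd_of_inner (inner_of_mem_frPl hp)]
  simp

/-- The orientations `(+,+,−,−)` on `frPl`. [folklore] -/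
theorem fr_hor : ∀ p ∈ frPl, (frBd p 0).2 = true ∧ (frBd p 1).2 = true ∧ (frBd p 2).2 = false ∧ (frBd p 3).2 = false := by
  intro p hp
  rw [frBd_of_inner (inner_of_mem_frPl hp)]
  simp

/-- The moving bonds are letters: `toyΛ ⊆ frΛ`. [folklore] -/
theorem toyΛ_subset_frΛ : toyΛ ⊆ frΛ := by
  intro b hb
  simp only [toyΛ, Finset.mem_insert, Finset.mem_singleton] at hb
  rcases hb with rfl | rfl | rfl | rfl <;> refine mem_frΛ_iff.2 fun i => ?_ <;> fin_cases i <;> simp [e_apply]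

/-- The inclusion of the MOVING bonds among the letters. [folklore] -/
def incl (c : ↥toyΛ) : ↥frΛ := ⟨c.1, toyΛ_subset_frΛ c.2⟩

/-- **THE OWNER'S `hst` HOLDS: the full plaquette star of every MOVING bond lies in `frPl`.** [folklore] -/
theorem fr_hst : ∀ c : ↥toyΛ, plaqStar (incl c).1.1 (incl c).1.2 ⊆ frPl := by
  rintro ⟨b, hb⟩
  simp only [toyΛ, Finset.mem_insert, Finset.mem_singleton] at hb
  rcases hb with rfl | rfl | rfl | rfl <;> simp only [incl] <;> decide

/-- A FROZEN letter exists: `(-e₁, 0)` is a letter of `p_{01}(−e₁) ∈ frPl` and not a moving bond. [folklore] -/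
theorem fr_frozen_letter : ((-e 1 : Site 2), (0 : Fin 2)) ∈ frΛ ∧ ((-e 1 : Site 2), (0 : Fin 2)) ∉ toyΛ := by
  refine ⟨mem_frΛ_iff.2 fun i => by fin_cases i <;> simp [e_apply], fun h => ?_⟩
  simp only [toyΛ, Finset.mem_insert, Finset.mem_singleton, Prod.mk.injEq] at h
  rcases h with ⟨h, -⟩ | ⟨h, -⟩ | ⟨h, -⟩ | ⟨h, -⟩ <;> have h1 := congrArg (fun v : Site 2 => v 1) h <;>
    simp [e_apply] at h1

/-! ## §2 The analytic binders on the toy and the END fired -/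

section Fires

variable {𝔸 : Type*} [NormedRing 𝔸] [NormOneClass 𝔸] [NormedAlgebra ℂ 𝔸] [CompleteSpace 𝔸] (τ : 𝔸 →L[ℂ] ℂ)

omit [NormOneClass 𝔸] in
/-- `U₀ ≡ 1` is flat on every plaquette of `frPl`. [folklore] -/
theorem fr_hreg : ∀ p ∈ frPl,
    ‖(plaqWord (fun b : ↥frΛ => toyU 𝔸 b.1.1 b.1.2) (frBd p) (0 : ↥frΛ → 𝔸) : 𝔸) - 1‖
      ≤ 0 * ((1 : ℝ) / unitW (Fin 2 × Fin 2 × Site 2) p) ^ 2 := by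
  intro p hp
  obtain ⟨h0, h1, h2, h3⟩ := fr_hor p hp
  rw [plaqWord_zero_eq (fun b : ↥frΛ => toyU 𝔸 b.1.1 b.1.2) (frBd p) h0 h1 h2 h3]
  simp [toyU]

omit [NormOneClass 𝔸] [CompleteSpace 𝔸] in
/-- ∇-datum domination for `covD frΛ 1 toyU` with unit weights, read at the moving bonds. [folklore] -/
theorem fr_hDv (A : ↥frΛ → 𝔸) (c : ↥toyΛ) (x : Site 2) (κ' τ' : Fin 2) (hx : x ∈ baseSites (incl c).1.1) :
    unitW ↥frΛ (incl c) ^ 2 * ‖covDerivFwd 1 (toyU 𝔸) κ' (fun z => ext frΛ A z τ') x‖ ≤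
      ‖(WSup.toPiL (unitW ↥(covIdx frΛ)) 2).symm (covD (𝔸 := 𝔸) frΛ 1 (toyU 𝔸) A)‖ :=
  hDv_unit_of_flat frΛ (covD (𝔸 := 𝔸) frΛ 1 (toyU 𝔸)) (fun A y κ τ => norm_covDerivFwd_ext_le frΛ 1 (toyU 𝔸) A y κ τ)
    A (incl c) x κ' τ' hx

omit [NormedAlgebra ℂ 𝔸] [CompleteSpace 𝔸] in
/-- `U₀ ≡ 1 ∈ U1` on the letters. [folklore] -/
theorem fr_h₀ : ∀ (y : Site 2) (κ : Fin 2), toyU 𝔸 y κ ∈ U1 𝔸 := toy_h₀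

/-- **THE FROZEN-BOUNDARY END FIRES ON A NONEMPTY BLOCK WITH GENUINELY FROZEN LETTERS.**  Part 5's
`prop4Hyp_pinned_ord₃_eta_levels_frozen_torusPin` APPLIED to the toy: letters `frΛ` (the `[-1,2]²` box), plaquettes
`frPl` (the five plaquettes of the moving bonds' stars), boundary words `frBd`, moving bonds `incl : ↥toyΛ → ↥frΛ`
(`toyΛ ≠ ∅`, part 4 `toy_nonempty`; a frozen letter exists, `fr_frozen_letter`), FULL STARS `fr_hst`, `U₀ ≡ 1`, `η = 1`,
unit weights, `Lc = 1`, `ε = 1∕4`, `ε₀ = 0`, torus `T = 3`, `toyB₀`, `δ′ = 0`, any complete normed algebra with a tracial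
`τ` — EVERY hypothesis discharged in kernel: `Prop4Hyp (W_pin^{out}) M (1∕8)` with the ORIGINAL stencil constant.
[folklore] -/
theorem toy_frozen_fires (htr : ∀ P Q : 𝔸, τ (P * Q) = τ (Q * P)) :
    Prop4Hyp (fun Y : WMax (fun b => unitW ↥frΛ b * pinW 0 (pinDist toyB₀ toyB₀_nonempty ∘ fun b : ↥frΛ => proj 3 b.1.1) b)
        (unitW ↥(covIdx frΛ)) (covD (𝔸 := 𝔸) frΛ 1 (toyU 𝔸)) =>
        ((WSup.toPiL (fun c : ↥toyΛ => unitW ↥frΛ (incl c) ^ 3 *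
            pinW 0 (pinDist toyB₀ toyB₀_nonempty ∘ fun c : ↥toyΛ => proj 3 (incl c).1.1) c) 1).symm
          (fun c : ↥toyΛ => locGrad (etaScale 1 (fun A : ↥frΛ → 𝔸 =>
              ∑ p ∈ frPl, ord₃ (plaqFunSym τ (fun b : ↥frΛ => toyU 𝔸 b.1.1 b.1.2) (frBd p)) A))
            (WMax.toPiL (fun b => unitW ↥frΛ b *
              pinW 0 (pinDist toyB₀ toyB₀_nonempty ∘ fun b : ↥frΛ => proj 3 b.1.1) b)
              (unitW ↥(covIdx frΛ)) (covD (𝔸 := 𝔸) frΛ 1 (toyU 𝔸)) Y) (incl c)) :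
          WSup (fun c : ↥toyΛ => unitW ↥frΛ (incl c) ^ 3 *
            pinW 0 (pinDist toyB₀ toyB₀_nonempty ∘ fun c : ↥toyΛ => proj 3 (incl c).1.1) c) 1 (𝔸 →L[ℂ] ℂ)))
      (((72 * (((2 : ℕ) : ℝ) - 1) * ‖τ‖ * (1 : ℝ) ^ 3) * ((3 * 2 + 2) * 2 : ℕ)
          + 8 * (‖τ‖ * (248 / 3 * (0 : ℝ) + 40 / 3 * (1 / 4 : ℝ))) * (1 : ℝ) ^ 4 * (4 * (4 * 2 : ℕ)))
        * Real.exp (0 * 2))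
      ((1 / 4 : ℝ) / 2) :=
  prop4Hyp_pinned_ord₃_eta_levels_frozen_torusPin frΛ frPl τ fr_h₀ frBd (unitW ↥frΛ) (unitW ↥(covIdx frΛ))
    (covD (𝔸 := 𝔸) frΛ 1 (toyU 𝔸)) (unitW ↥frΛ) (unitW ↥frΛ) (unitW (Fin 2 × Fin 2 × Site 2)) incl one_pos htr
    fr_hincr le_rfl fr_hst fr_hbd fr_hor (fun _ => one_pos) (fun _ _ _ => le_rfl) (fun _ => by simp) (fun _ => by simp)
    (fr_hDv (𝔸 := 𝔸)) (by norm_num) le_rfl (by norm_num) (fun _ _ => by simp) (fun _ _ _ _ => le_rfl)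
    (fun _ _ _ _ => by simp) (fr_hreg (𝔸 := 𝔸)) (by norm_num) toyB₀ toyB₀_nonempty le_rfl

end Fires

end Summit.QuantumFields.BalabanUV.T4Continuum.ShellMeasurePlaquetteCubicFrozenWitness

end
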